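import Literature.Topology.FourManifolds.NonSeparatingSpheresSides
import Literature.Topology.FourManifolds.NonSeparatingSpheresFibred
import Literature.Topology.FourManifolds.UnorientedDiscTheoremDiffeotopy
import Literature.Topology.FourManifolds.SmoothEmbeddingComp
import Literature.Topology.FourManifolds.SchoenfliesBallSide
import Literature.Topology.FourManifolds.Knots
import HarnessLib

/-!
# Budney–Gabai Thm. 3.13: straightening the lifted sphere and its deck translate

Fact seat of `Literature.Topology.FourManifolds.BudneyGabai2019_thm_3_13`
(`NonSeparatingSpheres.lean`; R. Budney, D. Gabai, *Knotted 3-balls in `S⁴`*, arXiv:1912.09029,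
Thm. 3.13: a non-separating smooth `Sⁿ ↪ S¹ × Sⁿ` is carried onto a fibre by a diffeomorphism).
This file performs the geometric step of the classical (`n ≤ 2`) argument on the cyclic cover:
given the Schoenflies theorem in ball form for hypersurface spheres `Sⁿ ↪ Sⁿ⁺¹` (hypothesis
`hSch`; proved in the tree for `n = 1`, `SphereEmbedding.schoenflies_exists_ball_one_two`, and
the named fact `SphereEmbedding.schoenflies_exists_ball` for `n = 2`), the lift `K̃ = ẽ(Sⁿ)` of a
non-separating sphere to `ℝ × Sⁿ` and its deck translate `τ K̃` are **simultaneously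
straightened**: there is a diffeomorphism `K` of `ℝ × Sⁿ` with `K(K̃) = {0} × Sⁿ`,
`K(τ K̃) = {b} × Sⁿ`, carrying the region below `K̃` to `{t < 0}` and the region below `τ K̃` to
`{t < b}` (`exists_straightening`, in the format consumed by
`exists_fibrationFunction_of_straightening`, `NonSeparatingSpheresFibrationFunction.lean`).

The construction reads everything inside `Sⁿ⁺¹ ⊃ ι(ℝ × Sⁿ)` (`ι = CylinderToSphere.map n`,
`CylinderToSphereEmbedding.lean`), where `Z₁ = ι(K̃)` and `Z₂ = ι(τ K̃)` bound Schoenflies balls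
filling their lower, resp. upper, sides (`NonSeparatingSpheresSides.lean`):

* `exists_disc_range_subset` — a disc can be reparametrised (`squeeze ∘ homothety`) so that its
  closed unit ball, unit sphere and open unit ball keep their images while the whole range
  shrinks into any open set containing the closed-ball image;
* `exists_diffeomorph_two_discs` — **two disjointly nested discs in `Sⁿ⁺¹` are simultaneously
  standard**: if `d₁` misses `N` and swallows `S`, and `d₂` swallows `N` and misses `d₁(𝔻)`,
  there is a diffeomorphism of `Sⁿ⁺¹` fixing both poles with `d₁(∂𝔻) ↦ {⟪z, N⟫ = sin (arctan 0)}`,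
  `d₁(B̊) ↦ {⟪z, N⟫ < sin (arctan 0)}`, `d₂(∂𝔻) ↦ {⟪z, N⟫ = sin (arctan 1)}`,
  `d₂(𝔻) ↦ {sin (arctan 1) ≤ ⟪z, N⟫}` — two applications of the unoriented disc theorem with
  compact support (`exists_isCompactlyDiffeotopicToIdIn_apply_disc_eq_or_reflect`; Palais 1960,
  Hirsch 1976 Ch. 8 §3) against the polar caps (`CylinderToSphere.exists_cap_disc`), each
  followed by a point push restoring the pole
  (`Diffeomorph.exists_isCompactlyDiffeotopicToIdIn_apply_eq`);
* `exists_cylinder_diffeomorph_of_apply_poles` — a diffeomorphism of `Sⁿ⁺¹` fixing the poles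
  restricts, through `ι`, to a diffeomorphism of `ℝ × Sⁿ`;
* `exists_straightening` — the assembly.

Everything here is proved; no definition and no named fact is introduced.

## References

* R. Budney, D. Gabai, *Knotted 3-balls in `S⁴`*, arXiv:1912.09029 (v2), §3, Thm. 3.13.
  [BudneyGabai2019]
* R. Palais, *Extending diffeomorphisms*, Proc. AMS 11 (1960), Thm. B. [Palais1960]
* M. W. Hirsch, *Differential Topology*, GTM 33 (1976), Ch. 8 §1 and §3, Thm. 3.1.
  [HirschDT1976]
-/

noncomputable section

open scoped Manifold ContDiff Topology Real RealInnerProductSpace Pointwise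
open Set Function Metric Module

namespace Literature.Topology.FourManifolds

local notation "𝔼 " k:arg => EuclideanSpace ℝ (Fin k)
local notation "𝕊 " k:arg => (Metric.sphere (0 : EuclideanSpace ℝ (Fin (k + 1))) 1)

/-! ### Generalities on compactly supported diffeomorphisms and discs -/

section General

variable {EN HN : Type*} [NormedAddCommGroup EN] [NormedSpace ℝ EN] [TopologicalSpace HN]
  {J : ModelWithCorners ℝ EN HN} {N : Type*} [TopologicalSpace N] [ChartedSpace HN N]

/-- A diffeomorphism compactly diffeotopic to the identity inside `W` maps `W` onto itself.
[folklore] -/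
theorem Diffeomorph.IsCompactlyDiffeotopicToIdIn.image_eq_self {W : Set N} {φ : N ≃ₘ⟮J, J⟯ N}
    (h : Diffeomorph.IsCompactlyDiffeotopicToIdIn W φ) : φ '' W = W := by
  obtain ⟨D, K, -, hKW, hD, hDK⟩ := h
  have hfix : ∀ x, x ∉ K → φ x = x := fun x hx ↦ by
    rw [← hD, Diffeotopy.coe_stage]; exact hDK 1 x hx
  have hKc : φ '' Kᶜ = Kᶜ := EqOn.image_eq_self fun x hx ↦ hfix x hx
  have hK : φ '' K = K := by
    have := image_compl_eq (s := K) (EquivLike.bijective φ)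
    rw [hKc] at this
    exact (compl_inj_iff.1 this).symm
  apply subset_antisymm
  · rintro _ ⟨x, hx, rfl⟩
    by_cases hxK : x ∈ K
    · exact hKW (hK ▸ mem_image_of_mem φ hxK)
    · rw [hfix x hxK]; exact hx
  · intro x hx
    by_cases hxK : x ∈ K
    · rw [← hK] at hxK
      obtain ⟨y, hy, rfl⟩ := hxK
      exact ⟨y, hKW hy, rfl⟩
    · exact ⟨x, hx, hfix x hxK⟩

/-- A diffeomorphism compactly diffeotopic to the identity inside `W` fixes every set disjoint
from `W`. [folklore] -/
theorem Diffeomorph.IsCompactlyDiffeotopicToIdIn.image_eq_of_disjoint {W : Set N}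
    {φ : N ≃ₘ⟮J, J⟯ N} (h : Diffeomorph.IsCompactlyDiffeotopicToIdIn W φ) {A : Set N}
    (hA : Disjoint A W) : φ '' A = A :=
  EqOn.image_eq_self fun _ hx ↦ h.apply_eq_self (disjoint_left.1 hA hx)

/-- **Images of norm-defined sets under the conclusion of the unoriented disc theorem**: if
`f (i y) = i' y` for `‖y‖ ≤ 1`, or `f (i (r y)) = i' y` for `‖y‖ ≤ 1` with `r` a linear
isometry, then `f (i (A)) = i' (A)` for every `A = {y | ‖y‖ ∈ t}`, `t ⊆ (-∞, 1]`. [folklore] -/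
theorem image_image_norm_preimage_eq {m : ℕ} {M : Type*} {i i' : 𝔼 m → M} {f : M → M}
    (r : 𝔼 m ≃ₗᵢ[ℝ] 𝔼 m)
    (h : (∀ y, ‖y‖ ≤ 1 → f (i y) = i' y) ∨ (∀ y, ‖y‖ ≤ 1 → f (i (r y)) = i' y))
    {t : Set ℝ} (ht : t ⊆ Iic 1) :
    f '' (i '' ((‖·‖) ⁻¹' t)) = i' '' ((‖·‖) ⁻¹' t) := by
  rcases h with h | h
  · apply subset_antisymm
    · rintro _ ⟨_, ⟨y, hy, rfl⟩, rfl⟩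
      exact ⟨y, hy, (h y (ht hy)).symm⟩
    · rintro _ ⟨y, hy, rfl⟩
      exact ⟨i y, ⟨y, hy, rfl⟩, h y (ht hy)⟩
  · apply subset_antisymm
    · rintro _ ⟨_, ⟨y, hy, rfl⟩, rfl⟩
      have hy' : ‖r.symm y‖ ∈ t := by rw [r.symm.norm_map]; exact hy
      refine ⟨r.symm y, hy', ?_⟩
      rw [← h (r.symm y) (ht hy'), r.apply_symm_apply]
    · rintro _ ⟨y, hy, rfl⟩
      have hy' : ‖r y‖ ∈ t := by rw [r.norm_map]; exact hy
      exact ⟨i (r y), ⟨r y, hy', rfl⟩, h y (ht hy)⟩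

/-- The closed unit ball as a norm preimage. [folklore] -/
theorem closedBall_eq_norm_preimage {m : ℕ} :
    closedBall (0 : 𝔼 m) 1 = (‖·‖) ⁻¹' Iic 1 := by
  ext; simp

/-- The unit sphere as a norm preimage. [folklore] -/
theorem sphere_eq_norm_preimage {m : ℕ} :
    sphere (0 : 𝔼 m) 1 = (‖·‖) ⁻¹' {1} := by
  ext; simp

/-- The open unit ball as a norm preimage. [folklore] -/
theorem ball_eq_norm_preimage {m : ℕ} :
    ball (0 : 𝔼 m) 1 = (‖·‖) ⁻¹' Iio 1 := by
  ext; simp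

/-- **A reflection**: `ℝᵐ⁺¹` has a linear isometry of negative determinant. [folklore] -/
theorem exists_linearIsometryEquiv_det_neg (m : ℕ) :
    ∃ r : 𝔼 (m + 1) ≃ₗᵢ[ℝ] 𝔼 (m + 1),
      LinearMap.det (r.toLinearEquiv : 𝔼 (m + 1) →ₗ[ℝ] 𝔼 (m + 1)) < 0 := by
  set w : 𝔼 (m + 1) := EuclideanSpace.single 0 1 with hw
  have hne : w ≠ 0 := fun h ↦ by
    have := congrArg (fun v : 𝔼 (m + 1) ↦ v 0) h
    simp [hw] at this
  refine ⟨(ℝ ∙ w)ᗮ.reflection, ?_⟩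
  have h := (ℝ ∙ w)ᗮ.det_reflection
  rw [Submodule.orthogonal_orthogonal, finrank_span_singleton hne, pow_one] at h
  have h' : LinearMap.det (((ℝ ∙ w)ᗮ.reflection).toLinearEquiv :
      𝔼 (m + 1) →ₗ[ℝ] 𝔼 (m + 1)) = -1 := h
  rw [h']
  norm_num

/-- **Reparametrising a disc into a neighbourhood of its closed ball.**  A smooth embedding
`d : ℝᵐ → M` can be replaced by `d ∘ h_R ∘ (s •)` (`h_R` the squeeze of `ℝᵐ` onto `B(0, R)`,
`R s = √(1 + s²)`), which has the same images of the closed unit ball, the unit sphere and the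
open unit ball, and whose range `d(B(0, R))` lies in any prescribed open `U ⊇ d(𝔻)`.
[folklore] -/
theorem exists_disc_range_subset {m : ℕ} {EM HM : Type*} [NormedAddCommGroup EM]
    [NormedSpace ℝ EM] [TopologicalSpace HM] {IM : ModelWithCorners ℝ EM HM} {M : Type*}
    [TopologicalSpace M] [ChartedSpace HM M] [IsManifold IM ∞ M]
    {d : 𝔼 m → M} (hd : Manifold.IsSmoothEmbedding 𝓘(ℝ, 𝔼 m) IM ∞ d) {U : Set M}
    (hU : IsOpen U) (hdU : d '' closedBall 0 1 ⊆ U) :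
    ∃ d' : 𝔼 m → M, Manifold.IsSmoothEmbedding 𝓘(ℝ, 𝔼 m) IM ∞ d' ∧ range d' ⊆ U ∧
      d' '' closedBall 0 1 = d '' closedBall 0 1 ∧ d' '' sphere 0 1 = d '' sphere 0 1 ∧
      d' '' ball 0 1 = d '' ball 0 1 := by
  -- a ball of radius `> 1` inside `d ⁻¹' U`
  obtain ⟨δ, hδ, hδU⟩ := (isCompact_closedBall (0 : 𝔼 m) 1).exists_thickening_subset_open
    (hU.preimage hd.contMDiff.continuous) (fun y hy ↦ hdU (mem_image_of_mem d hy))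
  rw [thickening_closedBall hδ zero_le_one] at hδU
  -- the parameters `s`, `R`
  set s : ℝ := 1 / δ + 1 with hs
  have hδ' : 0 < 1 / δ := by positivity
  have hs0 : 0 < s := by linarith
  have hδs : 1 ≤ δ * s := by
    rw [hs, mul_add, mul_one_div_cancel hδ.ne', mul_one]; linarith
  set R : ℝ := Real.sqrt (1 + s ^ 2) / s with hR
  have hsq : 0 < Real.sqrt (1 + s ^ 2) := Real.sqrt_pos.2 (by positivity)
  have hR0 : 0 < R := by positivity
  have hRs : R * (s / Real.sqrt (1 + s ^ 2)) = 1 := by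
    rw [hR]; field_simp
  have hR1 : R ≤ δ + 1 := by
    rw [hR, div_le_iff₀ hs0]
    calc Real.sqrt (1 + s ^ 2) ≤ Real.sqrt (((δ + 1) * s) ^ 2) :=
          Real.sqrt_le_sqrt (by nlinarith [hδs, sq_nonneg (δ * s)])
      _ = (δ + 1) * s := Real.sqrt_sq (by positivity)
  -- the homothety and the squeeze
  set L : 𝔼 m ≃L[ℝ] 𝔼 m :=
    (LinearEquiv.smulOfNeZero ℝ (𝔼 m) s hs0.ne').toContinuousLinearEquiv with hL
  have hLapply : ∀ y, L.toDiffeomorph y = s • y := fun y ↦ rfl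
  have hLimage : ∀ A : Set (𝔼 m), L.toDiffeomorph '' A = s • A := fun A ↦ by
    rw [← image_smul]; exact image_congr fun y _ ↦ hLapply y
  have hemb₁ : Manifold.IsSmoothEmbedding 𝓘(ℝ, 𝔼 m) IM ∞
      (d ∘ OpenPartialHomeomorph.univBall (0 : 𝔼 m) R) :=
    hd.comp_openPartialHomeomorph (OpenPartialHomeomorph.univBall (0 : 𝔼 m) R)
      (OpenPartialHomeomorph.univBall_source 0 R)
      OpenPartialHomeomorph.contDiff_univBall.contMDiff.contMDiffOn
      (by
        rw [OpenPartialHomeomorph.univBall_target 0 hR0]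
        exact OpenPartialHomeomorph.contDiffOn_univBall_symm.contMDiffOn)
  have hemb : Manifold.IsSmoothEmbedding 𝓘(ℝ, 𝔼 m) IM ∞
      ((d ∘ OpenPartialHomeomorph.univBall (0 : 𝔼 m) R) ∘ L.toDiffeomorph) :=
    hemb₁.comp_diffeomorph L.toDiffeomorph
  have hsq_eq : (OpenPartialHomeomorph.univBall (0 : 𝔼 m) R : 𝔼 m → 𝔼 m) =
      ClosedDiscExtension.squeeze R := rfl
  have himage : ∀ A : Set (𝔼 m),
      ((d ∘ OpenPartialHomeomorph.univBall (0 : 𝔼 m) R) ∘ L.toDiffeomorph) '' A =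
        d '' (ClosedDiscExtension.squeeze R '' (s • A)) := fun A ↦ by
    rw [image_comp, image_comp, hLimage, hsq_eq]
  have hnorm : ‖s‖ = s := Real.norm_of_nonneg hs0.le
  have hcb : ((d ∘ OpenPartialHomeomorph.univBall (0 : 𝔼 m) R) ∘ L.toDiffeomorph) ''
      closedBall 0 1 = d '' closedBall 0 1 := by
    rw [himage, smul_closedBall' hs0.ne', smul_zero, hnorm, mul_one,
      ClosedDiscExtension.image_squeeze_closedBall hR0 hs0.le, hRs]
  have hsp : ((d ∘ OpenPartialHomeomorph.univBall (0 : 𝔼 m) R) ∘ L.toDiffeomorph) ''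
      sphere 0 1 = d '' sphere 0 1 := by
    rw [himage, smul_sphere' hs0.ne', smul_zero, hnorm, mul_one,
      ClosedDiscExtension.image_squeeze_sphere hR0 hs0.le, hRs]
  refine ⟨(d ∘ OpenPartialHomeomorph.univBall (0 : 𝔼 m) R) ∘ L.toDiffeomorph, hemb, ?_, hcb,
    hsp, ?_⟩
  · -- the range is `d (B(0, R)) ⊆ U`
    rw [(EquivLike.surjective L.toDiffeomorph).range_comp, range_comp, hsq_eq,
      ClosedDiscExtension.range_squeeze hR0]
    rintro _ ⟨y, hy, rfl⟩
    exact hδU (ball_subset_ball hR1 hy)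
  · rw [← closedBall_sdiff_sphere, image_sdiff hemb.isEmbedding.injective, hcb, hsp,
      ← image_sdiff hd.isEmbedding.injective]

end General

/-! ### The poles -/

namespace CylinderToSphere

/-- The south pole is the antipode of the north pole. [folklore] -/
theorem coe_southPole_eq_neg (n : ℕ) :
    ((southPole n : 𝕊 (n + 1)) : 𝔼 (n + 1 + 1)) = -((northPole n : 𝕊 (n + 1)) : 𝔼 (n + 1 + 1)) :=
  (inner_eq_neg_one_iff_of_norm_eq_one (𝕜 := ℝ) (norm_eq_of_mem_sphere _)
    (norm_eq_of_mem_sphere _)).1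
    (inner_southPole_northPole n)

end CylinderToSphere

namespace BudneyGabai2019_thm_3_13

open CylinderToSphere SphereHypersurfaceSides

variable {n : ℕ}

/-! ### Two disjointly nested discs in `Sⁿ⁺¹` are simultaneously standard -/

/-- **Two disjointly nested discs in `Sⁿ⁺¹` are simultaneously standard.**  Let
`d₁, d₂ : ℝⁿ⁺¹ → Sⁿ⁺¹` be discs (smooth embeddings) such that `d₁` misses the north pole `N`
and contains the south pole `S` in `d₁(B̊)`, while `d₂` misses `d₁(𝔻)` and contains `N` in
`d₂(B̊)`.  Then a diffeomorphism `Ψ` of `Sⁿ⁺¹` fixing `N` and `S` carries `d₁(∂𝔻)` onto the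
latitude sphere `{⟪z, N⟫ = sin (arctan 0)}`, `d₁(B̊)` onto the open cap below it, `d₂(∂𝔻)` onto
`{⟪z, N⟫ = sin (arctan 1)}` and `d₂(𝔻)` onto the closed cap above it.  Proof: the unoriented
disc theorem with compact support in `Sⁿ⁺¹ ∖ {N}` (Palais 1960, Thm. B; Hirsch 1976, Ch. 8 §3,
Thm. 3.1 with §1, Thms. 1.3–1.4) moves `d₁` onto the south-cap disc, a point push inside the
open south cap restores `S`; then the disc theorem inside the open north hemisphere moves the
image of `d₂` onto the cap disc of latitude `sin (arctan 1)`, and a point push inside that open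
cap restores `N`. [cite: HirschDT1976, Ch. 8 §3, Thm. 3.1] [cite: Palais1960, Thm. B] -/
theorem exists_diffeomorph_two_discs {d₁ d₂ : 𝔼 (n + 1) → 𝕊 (n + 1)}
    (hd₁ : Manifold.IsSmoothEmbedding 𝓘(ℝ, 𝔼 (n + 1)) (𝓡 (n + 1)) ∞ d₁)
    (hd₂ : Manifold.IsSmoothEmbedding 𝓘(ℝ, 𝔼 (n + 1)) (𝓡 (n + 1)) ∞ d₂)
    (hN₁ : northPole n ∉ range d₁) (hS₁ : southPole n ∈ d₁ '' ball 0 1)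
    (h₁₂ : Disjoint (range d₂) (d₁ '' closedBall 0 1)) (hN₂ : northPole n ∈ d₂ '' ball 0 1) :
    ∃ Ψ : 𝕊 (n + 1) ≃ₘ⟮𝓡 (n + 1), 𝓡 (n + 1)⟯ 𝕊 (n + 1),
      Ψ (northPole n) = northPole n ∧ Ψ (southPole n) = southPole n ∧
      Ψ '' (d₁ '' sphere 0 1) = {z : 𝕊 (n + 1) |
        ⟪(z : 𝔼 (n + 1 + 1)), ((northPole n : 𝕊 (n + 1)) : 𝔼 (n + 1 + 1))⟫ =
          Real.sin (Real.arctan 0)} ∧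
      Ψ '' (d₁ '' ball 0 1) = {z : 𝕊 (n + 1) |
        ⟪(z : 𝔼 (n + 1 + 1)), ((northPole n : 𝕊 (n + 1)) : 𝔼 (n + 1 + 1))⟫ <
          Real.sin (Real.arctan 0)} ∧
      Ψ '' (d₂ '' sphere 0 1) = {z : 𝕊 (n + 1) |
        ⟪(z : 𝔼 (n + 1 + 1)), ((northPole n : 𝕊 (n + 1)) : 𝔼 (n + 1 + 1))⟫ =
          Real.sin (Real.arctan 1)} ∧
      Ψ '' (d₂ '' closedBall 0 1) = {z : 𝕊 (n + 1) | Real.sin (Real.arctan 1) ≤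
        ⟪(z : 𝔼 (n + 1 + 1)), ((northPole n : 𝕊 (n + 1)) : 𝔼 (n + 1 + 1))⟫} := by
  -- ### notation and the caps
  haveI : Fact (finrank ℝ (𝔼 (n + 1 + 1)) = n + 1 + 1) := ⟨finrank_euclideanSpace_fin⟩
  have hSN := coe_southPole_eq_neg n
  have hκ₀ := sin_arctan_mem_Ioo 0
  have hκ₁ := sin_arctan_mem_Ioo 1
  have hκ₀₁ : Real.sin (Real.arctan 0) < Real.sin (Real.arctan 1) :=
    sin_arctan_lt_sin_arctan_iff.2 zero_lt_one
  have hnegκ₀ : -Real.sin (Real.arctan 0) ∈ Ioo (-1 : ℝ) 1 :=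
    ⟨by linarith [hκ₀.2], by linarith [hκ₀.1]⟩
  have hnegκ₁ : -Real.sin (Real.arctan 1) ∈ Ioo (-1 : ℝ) 1 :=
    ⟨by linarith [hκ₁.2], by linarith [hκ₁.1]⟩
  obtain ⟨c₁, hc₁, hc₁0, hc₁D, hc₁S, hc₁r⟩ := exists_cap_disc (m := n + 1) (northPole n) hκ₀
  obtain ⟨c₂, hc₂, hc₂0, hc₂D, hc₂S, hc₂r⟩ := exists_cap_disc (m := n + 1) (southPole n) hnegκ₁
  obtain ⟨c₃, hc₃, -, hc₃D, hc₃S, -⟩ := exists_cap_disc (m := n + 1) (southPole n) hnegκ₀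
  -- the caps about `S`, in terms of `N`
  have hle : ∀ κ : ℝ, {p : 𝕊 (n + 1) | ⟪(p : 𝔼 (n + 1 + 1)),
      ((southPole n : 𝕊 (n + 1)) : 𝔼 (n + 1 + 1))⟫ ≤ -κ} =
      {p : 𝕊 (n + 1) | κ ≤ ⟪(p : 𝔼 (n + 1 + 1)), ((northPole n : 𝕊 (n + 1)) : 𝔼 (n + 1 + 1))⟫} :=
    fun κ ↦ by ext p; rw [mem_setOf_eq, mem_setOf_eq, hSN, inner_neg_right, neg_le_neg_iff]
  have heq : ∀ κ : ℝ, {p : 𝕊 (n + 1) | ⟪(p : 𝔼 (n + 1 + 1)),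
      ((southPole n : 𝕊 (n + 1)) : 𝔼 (n + 1 + 1))⟫ = -κ} =
      {p : 𝕊 (n + 1) | ⟪(p : 𝔼 (n + 1 + 1)), ((northPole n : 𝕊 (n + 1)) : 𝔼 (n + 1 + 1))⟫ = κ} :=
    fun κ ↦ by ext p; rw [mem_setOf_eq, mem_setOf_eq, hSN, inner_neg_right, neg_inj]
  rw [hle] at hc₂D hc₃D
  rw [heq] at hc₂S hc₃S
  -- centres
  have hc₁0' : c₁ 0 = southPole n := Subtype.ext (hc₁0.trans hSN.symm)
  have hc₂0' : c₂ 0 = northPole n := Subtype.ext (by rw [hc₂0, hSN, neg_neg])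
  -- open-ball images of the caps
  have hball : ∀ {c : 𝔼 (n + 1) → 𝕊 (n + 1)}, Injective c →
      c '' ball 0 1 = c '' closedBall 0 1 \ c '' sphere 0 1 := fun hc ↦ by
    rw [← image_sdiff hc, closedBall_sdiff_sphere]
  have hc₁B : c₁ '' ball 0 1 = {z : 𝕊 (n + 1) |
      ⟪(z : 𝔼 (n + 1 + 1)), ((northPole n : 𝕊 (n + 1)) : 𝔼 (n + 1 + 1))⟫ <
        Real.sin (Real.arctan 0)} := by
    rw [hball hc₁.isEmbedding.injective, hc₁D, hc₁S]
    ext z; simp only [mem_sdiff, mem_setOf_eq]; exact lt_iff_le_and_ne.symm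
  have hc₂B : c₂ '' ball 0 1 = {z : 𝕊 (n + 1) | Real.sin (Real.arctan 1) <
      ⟪(z : 𝔼 (n + 1 + 1)), ((northPole n : 𝕊 (n + 1)) : 𝔼 (n + 1 + 1))⟫} := by
    rw [hball hc₂.isEmbedding.injective, hc₂D, hc₂S]
    ext z; simp only [mem_sdiff, mem_setOf_eq]
    rw [lt_iff_le_and_ne, ne_comm]
  have hc₃B : c₃ '' ball 0 1 = {z : 𝕊 (n + 1) | Real.sin (Real.arctan 0) <
      ⟪(z : 𝔼 (n + 1 + 1)), ((northPole n : 𝕊 (n + 1)) : 𝔼 (n + 1 + 1))⟫} := by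
    rw [hball hc₃.isEmbedding.injective, hc₃D, hc₃S]
    ext z; simp only [mem_sdiff, mem_setOf_eq]
    rw [lt_iff_le_and_ne, ne_comm]
  -- disjointness of the polar regions
  have hdisj₁ : Disjoint (c₁ '' closedBall 0 1) (c₃ '' ball 0 1) := by
    rw [hc₁D, hc₃B, Set.disjoint_left]
    intro z h1 h2
    rw [mem_setOf_eq] at h1 h2
    exact (h1.trans_lt h2).false
  have hdisj₂ : Disjoint (c₁ '' closedBall 0 1) (c₂ '' ball 0 1) := by
    rw [hc₁D, hc₂B, Set.disjoint_left]
    intro z h1 h2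
    rw [mem_setOf_eq] at h1 h2
    exact ((h1.trans_lt hκ₀₁).trans h2).false
  have hsub₁S : c₁ '' sphere 0 1 ⊆ c₁ '' closedBall 0 1 := image_mono sphere_subset_closedBall
  have hsub₁B : c₁ '' ball 0 1 ⊆ c₁ '' closedBall 0 1 := image_mono ball_subset_closedBall
  -- a reflection of the disc space
  obtain ⟨r, hr⟩ := exists_linearIsometryEquiv_det_neg n
  have hr' : LinearMap.det ((r.toContinuousLinearEquiv).toLinearEquiv :
      𝔼 (n + 1) →ₗ[ℝ] 𝔼 (n + 1)) < 0 := hr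
  -- ### Move 1: `d₁ ↦ c₁` inside `Sⁿ⁺¹ ∖ {N}`
  have hW₁o : IsOpen (range c₁) := by rw [hc₁r]; exact isOpen_compl_singleton
  have hW₁c : IsPreconnected (range c₁) := isPreconnected_range hc₁.contMDiff.continuous
  have hd₁W : range d₁ ⊆ range c₁ := by
    rw [hc₁r]; exact subset_compl_singleton_iff.2 hN₁
  obtain ⟨f₁, hf₁, hf₁eq⟩ := exists_isCompactlyDiffeotopicToIdIn_apply_disc_eq_or_reflect hd₁ hc₁
    r.toContinuousLinearEquiv hr' hW₁o hW₁c hd₁W Subset.rfl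
  have hf₁S : f₁ '' (d₁ '' sphere 0 1) = c₁ '' sphere 0 1 := by
    rw [sphere_eq_norm_preimage (m := n + 1)]
    exact image_image_norm_preimage_eq r hf₁eq (by simp)
  have hf₁B : f₁ '' (d₁ '' ball 0 1) = c₁ '' ball 0 1 := by
    rw [ball_eq_norm_preimage (m := n + 1)]
    exact image_image_norm_preimage_eq r hf₁eq Iio_subset_Iic_self
  have hf₁N : f₁ (northPole n) = northPole n :=
    hf₁.apply_eq_self (by rw [hc₁r]; exact fun h ↦ h rfl)
  have hNc₁ : northPole n ∉ c₁ '' ball 0 1 := fun h ↦ by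
    have h' := image_subset_range c₁ _ h
    rw [hc₁r] at h'
    exact h' rfl
  have hSc₂ : southPole n ∉ c₂ '' ball 0 1 := fun h ↦ by
    have h' := image_subset_range c₂ _ h
    rw [hc₂r] at h'
    exact h' rfl
  -- ### Push 1: restore `S` inside the open south cap `c₁(B̊)`
  have hWₛo : IsOpen (c₁ '' ball 0 1) := isOpenMap_disc hc₁ _ isOpen_ball
  have hWₛc : IsPreconnected (c₁ '' ball 0 1) :=
    (convex_ball (0 : 𝔼 (n + 1)) 1).isPreconnected.image _ hc₁.contMDiff.continuous.continuousOn
  have hSW : f₁ (southPole n) ∈ c₁ '' ball 0 1 := by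
    rw [← hf₁B]; exact mem_image_of_mem f₁ hS₁
  have hSW' : southPole n ∈ c₁ '' ball 0 1 := ⟨0, mem_ball_self one_pos, hc₁0'⟩
  obtain ⟨P₁, hP₁, hP₁S⟩ := Diffeomorph.exists_isCompactlyDiffeotopicToIdIn_apply_eq
    (n := n + 1) hWₛo hWₛc hSW hSW'
  set F₁ := f₁.trans P₁ with hF₁
  have hF₁S : F₁ (southPole n) = southPole n := by
    rw [hF₁, Diffeomorph.coe_trans, comp_apply, hP₁S]
  have hF₁N : F₁ (northPole n) = northPole n := by
    rw [hF₁, Diffeomorph.coe_trans, comp_apply, hf₁N]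
    exact hP₁.apply_eq_self hNc₁
  have hF₁sp : F₁ '' (d₁ '' sphere 0 1) = c₁ '' sphere 0 1 := by
    rw [hF₁, Diffeomorph.coe_trans, image_comp, hf₁S]
    exact hP₁.image_eq_of_disjoint ((disjoint_image_iff hc₁.isEmbedding.injective).2 sphere_disjoint_ball)
  have hF₁bl : F₁ '' (d₁ '' ball 0 1) = c₁ '' ball 0 1 := by
    rw [hF₁, Diffeomorph.coe_trans, image_comp, hf₁B]
    exact hP₁.image_eq_self
  have hF₁cb : F₁ '' (d₁ '' closedBall 0 1) = c₁ '' closedBall 0 1 := by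
    rw [← ball_union_sphere, image_union, image_union, hF₁sp, hF₁bl, image_union]
  -- ### Move 2: `F₁ ∘ d₂ ↦ c₂` inside the open north hemisphere `c₃(B̊)`
  have hW₂o : IsOpen (c₃ '' ball 0 1) := isOpenMap_disc hc₃ _ isOpen_ball
  have hW₂c : IsPreconnected (c₃ '' ball 0 1) :=
    (convex_ball (0 : 𝔼 (n + 1)) 1).isPreconnected.image _ hc₃.contMDiff.continuous.continuousOn
  have hc₂DW : c₂ '' closedBall 0 1 ⊆ c₃ '' ball 0 1 := by
    rw [hc₂D, hc₃B]; exact fun z (hz : _ ≤ _) ↦ hκ₀₁.trans_le hz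
  obtain ⟨c₂', hc₂', hc₂'r, hc₂'D, hc₂'S, hc₂'B⟩ := exists_disc_range_subset hc₂ hW₂o hc₂DW
  have hi : Manifold.IsSmoothEmbedding 𝓘(ℝ, 𝔼 (n + 1)) (𝓡 (n + 1)) ∞ (F₁ ∘ d₂) :=
    hd₂.diffeomorph_comp F₁
  have hiW : range (F₁ ∘ d₂) ⊆ c₃ '' ball 0 1 := by
    rw [range_comp]
    rintro _ ⟨w, hw, rfl⟩
    have hw' : F₁ w ∉ F₁ '' (d₁ '' closedBall 0 1) := fun h ↦
      disjoint_left.1 h₁₂ hw (((EquivLike.injective F₁).mem_set_image).1 h)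
    rw [hF₁cb, hc₁D, mem_setOf_eq, not_le] at hw'
    rw [hc₃B]
    exact hw'
  obtain ⟨f₂, hf₂, hf₂eq⟩ := exists_isCompactlyDiffeotopicToIdIn_apply_disc_eq_or_reflect hi hc₂'
    r.toContinuousLinearEquiv hr' hW₂o hW₂c hiW hc₂'r
  have hf₂S' : f₂ '' ((F₁ ∘ d₂) '' sphere 0 1) = c₂ '' sphere 0 1 := by
    rw [← hc₂'S, sphere_eq_norm_preimage (m := n + 1)]
    exact image_image_norm_preimage_eq r hf₂eq (by simp)
  have hf₂B' : f₂ '' ((F₁ ∘ d₂) '' ball 0 1) = c₂ '' ball 0 1 := by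
    rw [← hc₂'B, ball_eq_norm_preimage (m := n + 1)]
    exact image_image_norm_preimage_eq r hf₂eq Iio_subset_Iic_self
  have hf₂D' : f₂ '' ((F₁ ∘ d₂) '' closedBall 0 1) = c₂ '' closedBall 0 1 := by
    rw [← hc₂'D, closedBall_eq_norm_preimage (m := n + 1)]
    exact image_image_norm_preimage_eq r hf₂eq Subset.rfl
  -- `f₂` fixes the closed south cap pointwise
  have hf₂fix : ∀ A ⊆ c₁ '' closedBall 0 1, f₂ '' A = A := fun A hA ↦
    hf₂.image_eq_of_disjoint (hdisj₁.mono_left hA)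
  have hf₂S : f₂ (southPole n) = southPole n :=
    hf₂.apply_eq_self (disjoint_left.1 hdisj₁ ⟨0, mem_closedBall_self zero_le_one, hc₁0'⟩)
  -- ### Push 2: restore `N` inside the open cap `c₂(B̊)`
  have hWNo : IsOpen (c₂ '' ball 0 1) := isOpenMap_disc hc₂ _ isOpen_ball
  have hWNc : IsPreconnected (c₂ '' ball 0 1) :=
    (convex_ball (0 : 𝔼 (n + 1)) 1).isPreconnected.image _ hc₂.contMDiff.continuous.continuousOn
  have hNW : f₂ (northPole n) ∈ c₂ '' ball 0 1 := by
    rw [← hf₂B', image_comp]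
    refine mem_image_of_mem f₂ ?_
    rw [← hF₁N]
    exact mem_image_of_mem F₁ hN₂
  have hNW' : northPole n ∈ c₂ '' ball 0 1 := ⟨0, mem_ball_self one_pos, hc₂0'⟩
  obtain ⟨P₂, hP₂, hP₂N⟩ := Diffeomorph.exists_isCompactlyDiffeotopicToIdIn_apply_eq
    (n := n + 1) hWNo hWNc hNW hNW'
  have hP₂fix : ∀ A ⊆ c₁ '' closedBall 0 1, P₂ '' A = A := fun A hA ↦
    hP₂.image_eq_of_disjoint (hdisj₂.mono_left hA)
  -- ### the diffeomorphism
  set Ψ := F₁.trans (f₂.trans P₂) with hΨ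
  have hΨapply : ∀ z, Ψ z = P₂ (f₂ (F₁ z)) := fun z ↦ by
    rw [hΨ, Diffeomorph.coe_trans, Diffeomorph.coe_trans]; rfl
  have hΨimage : ∀ A, Ψ '' A = P₂ '' (f₂ '' (F₁ '' A)) := fun A ↦ by
    rw [hΨ, Diffeomorph.coe_trans, Diffeomorph.coe_trans, image_comp, image_comp]
  refine ⟨Ψ, ?_, ?_, ?_, ?_, ?_, ?_⟩
  · rw [hΨapply, hF₁N, hP₂N]
  · rw [hΨapply, hF₁S, hf₂S]
    exact hP₂.apply_eq_self hSc₂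
  · rw [hΨimage, hF₁sp, hf₂fix _ hsub₁S, hP₂fix _ hsub₁S, hc₁S]
  · rw [hΨimage, hF₁bl, hf₂fix _ hsub₁B, hP₂fix _ hsub₁B, hc₁B]
  · rw [hΨimage, ← image_comp F₁ d₂, hf₂S',
      hP₂.image_eq_of_disjoint ((disjoint_image_iff hc₂.isEmbedding.injective).2 sphere_disjoint_ball), hc₂S]
  · rw [hΨimage, ← image_comp F₁ d₂, hf₂D', ← hc₂D, ← ball_union_sphere, image_union,
      image_union, hP₂.image_eq_self,
      hP₂.image_eq_of_disjoint ((disjoint_image_iff hc₂.isEmbedding.injective).2 sphere_disjoint_ball)]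

/-! ### From the sphere back to the cylinder -/

/-- **A diffeomorphism of `Sⁿ⁺¹` fixing both poles restricts to a diffeomorphism of the
cylinder**: there is a diffeomorphism `K` of `ℝ × Sⁿ` with `ι ∘ K = Ψ ∘ ι` (`ι` is a
diffeomorphism onto `Sⁿ⁺¹ ∖ {N, S}`, `CylinderToSphere.isSmoothEmbedding_map`,
`CylinderToSphere.exists_contMDiffOn_leftInverse`). [folklore] -/
theorem exists_cylinder_diffeomorph_of_apply_poles
    (Ψ : 𝕊 (n + 1) ≃ₘ⟮𝓡 (n + 1), 𝓡 (n + 1)⟯ 𝕊 (n + 1))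
    (hN : Ψ (northPole n) = northPole n) (hS : Ψ (southPole n) = southPole n) :
    ∃ K : (ℝ × 𝕊 n) ≃ₘ⟮𝓘(ℝ, ℝ).prod (𝓡 n), 𝓘(ℝ, ℝ).prod (𝓡 n)⟯ (ℝ × 𝕊 n),
      ∀ p, map n (K p) = Ψ (map n p) := by
  obtain ⟨u, hu, hu'⟩ := exists_contMDiffOn_leftInverse n
  have hr : ∀ Φ : 𝕊 (n + 1) ≃ₘ⟮𝓡 (n + 1), 𝓡 (n + 1)⟯ 𝕊 (n + 1),
      Φ (northPole n) = northPole n → Φ (southPole n) = southPole n →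
        ∀ p, Φ (map n p) ∈ range (map n) := by
    intro Φ hΦN hΦS p
    rw [range_map]
    simp only [mem_compl_iff, mem_insert_iff, mem_singleton_iff, not_or]
    exact ⟨fun h ↦ map_ne_northPole n p (EquivLike.injective Φ (h.trans hΦN.symm)),
      fun h ↦ map_ne_southPole n p (EquivLike.injective Φ (h.trans hΦS.symm))⟩
  have key : ∀ Φ : 𝕊 (n + 1) ≃ₘ⟮𝓡 (n + 1), 𝓡 (n + 1)⟯ 𝕊 (n + 1),
      Φ (northPole n) = northPole n → Φ (southPole n) = southPole n →
        ∀ p, map n (u (Φ (map n p))) = Φ (map n p) := by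
    intro Φ hΦN hΦS p
    obtain ⟨q, hq⟩ := hr Φ hΦN hΦS p
    rw [← hq, hu']
  have hN' : Ψ.symm (northPole n) = northPole n := by
    have h := congrArg Ψ.symm hN
    rw [Ψ.symm_apply_apply] at h
    exact h.symm
  have hS' : Ψ.symm (southPole n) = southPole n := by
    have h := congrArg Ψ.symm hS
    rw [Ψ.symm_apply_apply] at h
    exact h.symm
  refine ⟨⟨⟨fun p ↦ u (Ψ (map n p)), fun p ↦ u (Ψ.symm (map n p)), fun p ↦ ?_, fun p ↦ ?_⟩,
    ?_, ?_⟩, fun p ↦ key Ψ hN hS p⟩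
  · simp only
    rw [key Ψ hN hS p, Ψ.symm_apply_apply, hu']
  · simp only
    rw [key Ψ.symm hN' hS' p, Ψ.apply_symm_apply, hu']
  · exact hu.comp_contMDiff (Ψ.contMDiff.comp (contMDiff_map n)) fun p ↦ hr Ψ hN hS p
  · exact hu.comp_contMDiff (Ψ.symm.contMDiff.comp (contMDiff_map n)) fun p ↦ hr Ψ.symm hN' hS' p

/-! ### The straightening -/

/-- **Simultaneous straightening of the lifted sphere and its deck translate** (the geometric
step of the classical proof of Budney–Gabai Thm. 3.13 for `n ≤ 2`).  Assume the Schoenflies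
theorem in ball form for smooth `Sⁿ ↪ Sⁿ⁺¹` (`hSch`).  Let `e : Sⁿ ↪ S¹ × Sⁿ` be a smooth
embedding with connected complement and `ẽ : Sⁿ → ℝ × Sⁿ` a lift (`(exp × id) ∘ ẽ = e`),
`τ (t, y) = (t + 2π, y)` the deck transformation.  Then there are a diffeomorphism `K` of
`ℝ × Sⁿ` and `b > 0` with: `pr₁ (K p) = 0 ↔ p ∈ ẽ(Sⁿ)`; `pr₁ (K (τ p)) < b ↔ pr₁ (K p) < 0` and
`pr₁ (K (τ p)) = b ↔ pr₁ (K p) = 0` (`K` straightens `τ ẽ(Sⁿ)` to the level `b`, lower sides to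
lower sides); and every deck orbit meets both `{pr₁ K < 0}` and `{pr₁ K ≥ 0}`.  Proof: read
`ẽ(Sⁿ)` and `τ ẽ(Sⁿ)` in `Sⁿ⁺¹ ⊃ ι(ℝ × Sⁿ)`; Schoenflies balls fill the lower side of the first
and the upper side of the second (`NonSeparatingSpheresSides.lean`); make both standard by
`exists_diffeomorph_two_discs` and pull the diffeomorphism back to the cylinder
(`exists_cylinder_diffeomorph_of_apply_poles`); the side correspondences under `τ` are
`neg_translate_iff_neg`, `eq_zero_translate_iff_eq_zero`, `exists_int_neg`,
`exists_int_nonneg`. [cite: BudneyGabai2019, Thm. 3.13 (arXiv v2 p. 22)] -/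
theorem exists_straightening (hn : 1 ≤ n)
    (hSch : ∀ (S : SphereEmbedding n (n + 1)) (p : 𝕊 (n + 1)), p ∉ range S →
      ∃ d : 𝔼 (n + 1) → 𝕊 (n + 1), Manifold.IsSmoothEmbedding 𝓘(ℝ, 𝔼 (n + 1)) (𝓡 (n + 1)) ∞ d ∧
        d '' sphere 0 1 = range S ∧ p ∉ d '' closedBall 0 1)
    {e : 𝕊 n → Circle × 𝕊 n} (he : Manifold.IsSmoothEmbedding (𝓡 n) ((𝓡 1).prod (𝓡 n)) ∞ e)
    (hconn : IsConnected (range e)ᶜ)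
    {el : 𝕊 n → ℝ × 𝕊 n} (hel : Manifold.IsSmoothEmbedding (𝓡 n) (𝓘(ℝ, ℝ).prod (𝓡 n)) ∞ el)
    (hlift : Prod.map Circle.exp id ∘ el = e) :
    ∃ (K : (ℝ × 𝕊 n) ≃ₘ⟮𝓘(ℝ, ℝ).prod (𝓡 n), 𝓘(ℝ, ℝ).prod (𝓡 n)⟯ (ℝ × 𝕊 n)) (b : ℝ), 0 < b ∧
      (∀ p, (K p).1 = 0 ↔ p ∈ range el) ∧
      (∀ p, (K (p.1 + 2 * π, p.2)).1 < b ↔ (K p).1 < 0) ∧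
      (∀ p, (K (p.1 + 2 * π, p.2)).1 = b ↔ (K p).1 = 0) ∧
      ∀ p : ℝ × 𝕊 n, (∃ k : ℤ, (K (p.1 + k * (2 * π), p.2)).1 < 0) ∧
        ∃ k : ℤ, 0 ≤ (K (p.1 + k * (2 * π), p.2)).1 := by
  -- ### the deck translate of the lift
  obtain ⟨T, hT⟩ : ∃ T : (ℝ × 𝕊 n) ≃ₘ⟮𝓘(ℝ, ℝ).prod (𝓡 n), 𝓘(ℝ, ℝ).prod (𝓡 n)⟯ (ℝ × 𝕊 n),
      ∀ p, T p = (p.1 + 2 * π, p.2) :=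
    ⟨⟨⟨fun p ↦ (p.1 + 2 * π, p.2), fun p ↦ (p.1 + -(2 * π), p.2), fun p ↦ by simp,
      fun p ↦ by simp⟩, Cylinder.contMDiff_translate (2 * π),
      Cylinder.contMDiff_translate (-(2 * π))⟩, fun p ↦ rfl⟩
  set el₂ : 𝕊 n → ℝ × 𝕊 n := (fun q : ℝ × 𝕊 n ↦ ((q.1 + 2 * π, q.2) : ℝ × 𝕊 n)) ∘ el
    with hel₂def
  have hel₂ : Manifold.IsSmoothEmbedding (𝓡 n) (𝓘(ℝ, ℝ).prod (𝓡 n)) ∞ el₂ := by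
    have h := hel.diffeomorph_comp T
    rwa [show ((T : ℝ × 𝕊 n → ℝ × 𝕊 n)) = fun q : ℝ × 𝕊 n ↦ ((q.1 + 2 * π, q.2) : ℝ × 𝕊 n)
      from funext hT] at h
  have hlift₂ : Prod.map Circle.exp id ∘ el₂ = e := by
    rw [← hlift]
    funext y
    refine Prod.ext ?_ ?_
    · simp only [hel₂def, comp_apply, Prod.map_fst]
      rw [Circle.exp_add, Circle.exp_two_pi, mul_one]
    · simp only [hel₂def, comp_apply, Prod.map_snd, id_eq]
  -- ### normalised side packages
  obtain ⟨g₁, hg₁, hS₁, hN₁⟩ := exists_isSidePackage_normalised hn he hconn hel hlift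
  obtain ⟨g₂, hg₂, hS₂, hN₂⟩ := exists_isSidePackage_normalised hn he hconn hel₂ hlift₂
  have hgc₁ : Continuous g₁ := hg₁.isRegularLevel.contMDiff.continuous
  have hg0₁ : ∀ z, g₁ z = 0 ↔ z ∈ range (map n ∘ el) := fun z ↦ by
    rw [← hg₁.preimage_zero]; rfl
  have hg0₂ : ∀ z, g₂ z = 0 ↔ z ∈ range (map n ∘ el₂) := fun z ↦ by
    rw [← hg₂.preimage_zero]; rfl
  -- ### Schoenflies balls filling the lower side of `Z₁` and the upper side of `Z₂`
  obtain ⟨D₁, hD₁, hD₁S, hD₁N⟩ := hSch ⟨map n ∘ el, isSmoothEmbedding_map_comp n hel⟩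
    (northPole n) (by rintro ⟨y, hy⟩; exact map_ne_northPole n _ hy)
  change D₁ '' sphere 0 1 = range (map n ∘ el) at hD₁S
  have hD₁cb : D₁ '' closedBall 0 1 = {z | g₁ z ≤ 0} :=
    image_closedBall_eq_of_isSidePackage hg₁ hD₁ hD₁S hN₁ hD₁N
  have hD₁bl : D₁ '' ball 0 1 = {z | g₁ z < 0} :=
    image_ball_eq_of_isSidePackage hg₁ hD₁ hD₁S hN₁ hD₁N
  obtain ⟨D₂, hD₂, hD₂S, hD₂Sm⟩ := hSch ⟨map n ∘ el₂, isSmoothEmbedding_map_comp n hel₂⟩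
    (southPole n) (by rintro ⟨y, hy⟩; exact map_ne_southPole n _ hy)
  change D₂ '' sphere 0 1 = range (map n ∘ el₂) at hD₂S
  obtain ⟨hD₂bl, hD₂cb⟩ := image_closedBall_eq_of_isSidePackage' hg₂ hD₂ hD₂S hS₂ hD₂Sm
  -- ### reparametrise: `d₁` misses `N`, `d₂` misses `{g₁ ≤ 0}`
  obtain ⟨d₁, hd₁, hd₁r, hd₁cb, hd₁sp, hd₁bl⟩ := exists_disc_range_subset hD₁
    (isOpen_compl_singleton (x := northPole n)) (by
      rw [hD₁cb]
      intro z hz h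
      rw [mem_singleton_iff] at h
      rw [h] at hz
      exact not_lt.2 hz hN₁)
  obtain ⟨d₂, hd₂, hd₂r, hd₂cb, hd₂sp, hd₂bl⟩ := exists_disc_range_subset hD₂
    (isOpen_lt continuous_const hgc₁) (by
      rw [hD₂cb]
      exact nonneg_translate_subset_pos hn he hel hlift hg₁ hN₁ hg₂ hS₂ hN₂)
  -- ### straighten both discs
  obtain ⟨Ψ, hΨN, hΨS, hΨ₁, hΨ₂, hΨ₃, hΨ₄⟩ := exists_diffeomorph_two_discs hd₁ hd₂
    (fun h ↦ hd₁r h rfl) (by rw [hd₁bl, hD₁bl]; exact hS₁)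
    (by
      rw [hd₁cb, hD₁cb, Set.disjoint_left]
      intro z hz hz'
      rw [mem_setOf_eq] at hz'
      have h1 : 0 < g₁ z := hd₂r hz
      exact not_lt.2 hz' h1)
    (by rw [hd₂bl, hD₂bl]; exact hN₂)
  rw [hd₁sp, hD₁S] at hΨ₁
  rw [hd₁bl, hD₁bl] at hΨ₂
  rw [hd₂sp, hD₂S] at hΨ₃
  rw [hd₂cb, hD₂cb] at hΨ₄
  -- ### back to the cylinder
  obtain ⟨K, hK⟩ := exists_cylinder_diffeomorph_of_apply_poles Ψ hΨN hΨS
  have hKiff : ∀ (P : ℝ × 𝕊 n → Prop) (p : ℝ × 𝕊 n),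
      P (K p) ↔ Ψ (map n p) ∈ map n '' {q | P q} := fun P p ↦ by
    rw [← hK p, (injective_map n).mem_set_image]; rfl
  have hΨinj : Injective Ψ := EquivLike.injective Ψ
  have hΨne : ∀ p : ℝ × 𝕊 n, Ψ (map n p) ≠ southPole n := fun p h ↦
    map_ne_southPole n p (hΨinj (h.trans hΨS.symm))
  have hunion : ∀ (p : ℝ × 𝕊 n) (A : Set (𝕊 (n + 1))),
      Ψ (map n p) ∈ A ↔ Ψ (map n p) ∈ A ∪ {southPole n} := fun p A ↦ by
    rw [mem_union, mem_singleton_iff, or_iff_left (hΨne p)]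
  -- the four dictionaries
  have hA : ∀ p, (K p).1 < 0 ↔ g₁ (map n p) < 0 := fun p ↦ by
    rw [hKiff (fun q ↦ q.1 < 0) p, hunion, ← setOf_inner_lt_eq, ← hΨ₂,
      hΨinj.mem_set_image]
    rfl
  have hB : ∀ p, (K p).1 < 1 ↔ g₂ (map n p) < 0 := fun p ↦ by
    rw [hKiff (fun q ↦ q.1 < 1) p, hunion, ← setOf_inner_lt_eq, mem_setOf_eq, ← not_le]
    have h2 : Real.sin (Real.arctan 1) ≤ ⟪((Ψ (map n p) : 𝕊 (n + 1)) : 𝔼 (n + 1 + 1)),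
        ((northPole n : 𝕊 (n + 1)) : 𝔼 (n + 1 + 1))⟫ ↔
        Ψ (map n p) ∈ Ψ '' {z | 0 ≤ g₂ z} := by
      rw [hΨ₄]; rfl
    rw [h2, hΨinj.mem_set_image, mem_setOf_eq, not_le]
  have hZ₁ : ∀ p, (K p).1 = 0 ↔ map n p ∈ range (map n ∘ el) := fun p ↦ by
    rw [hKiff (fun q ↦ q.1 = 0) p, ← setOf_inner_eq_eq, ← hΨ₁, hΨinj.mem_set_image]
  have hZ₂ : ∀ p, (K p).1 = 1 ↔ map n p ∈ range (map n ∘ el₂) := fun p ↦ by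
    rw [hKiff (fun q ↦ q.1 = 1) p, ← setOf_inner_eq_eq, ← hΨ₃, hΨinj.mem_set_image]
  refine ⟨K, 1, one_pos, fun p ↦ ?_, fun p ↦ ?_, fun p ↦ ?_, fun p ↦ ⟨?_, ?_⟩⟩
  · rw [hZ₁, range_comp, (injective_map n).mem_set_image]
  · rw [hB, hA]
    exact neg_translate_iff_neg hn he hconn hel hlift hg₁ hS₁ hN₁ hg₂ hS₂ hN₂ p
  · rw [hZ₂, hZ₁, ← hg0₂, ← hg0₁]
    exact eq_zero_translate_iff_eq_zero hg₁ hg₂ p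
  · obtain ⟨k, hk⟩ := exists_int_neg hgc₁ hS₁ hN₁ p
    exact ⟨k, (hA _).2 hk⟩
  · obtain ⟨k, hk⟩ := exists_int_nonneg hgc₁ hS₁ hN₁ p
    exact ⟨k, not_lt.1 fun h ↦ (not_lt.2 hk) ((hA _).1 h)⟩

end BudneyGabai2019_thm_3_13

end Literature.Topology.FourManifolds

end
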